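import Summits.NavierStokesRegularity.NavierStokesRegularity.Theorems.RungBlowupCofinal.NonlinearityLoadBearing
import Summits.NavierStokesRegularity.NavierStokesRegularity.Theorems.RungBlowupCofinal.OddProfilesExcluded
import Summits.NavierStokesRegularity.FluidComputer.AngularGalerkinLadderRotation
import Literature.Analysis.FluidPDE.IsometryInvariance
import HarnessLib

/-!
# SYMMETRY-ODD rung SOLUTIONS are excluded — the physical-variable (time-dependent) form of N7:
# a Type-I rung solution on `(−∞, 0)` whose every slice is reversed by a linear isometry,
# `σu(t, σ⁻¹x) = −u(t, x)`, vanishes; no rung profile and no window profile has EVEN slices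
# (route `AngularGalerkinLadder`, cruxes K1 `RungBlowupCofinal` / K2 `NoOverheating`;
# admissibility filter N7′, theorems only)

Cell `ns-blowup`, seat `ns-blowup-circuit` (g12, AGL Lean seat). Helper file for
`stmt-NavierStokesRegularity-19959` (and a census clause for `stmt-…-19960`): the parity principle
of `OddProfilesExcluded` (N7, precessing profiles) transported to the route's own objects
`AngularLadder.IsRungSolutionOn / IsRungProfile / IsWindowProfile` — no ansatz, no precession
rate, any DSS factor and rotation.

## The argument (`rungSolution_eq_zero_of_symmetryOdd`)

Let `(u, p, d)` be a rung-`L` solution on `(−∞, 0)` (`∂ₜu + (u·∇)u = Δu − ∇p + d`, slices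
band-limited, defect slices co-band-limited) with the Type-I bound
`‖u(t,x)‖ ≤ C₀/(‖x‖ + √−t)`, and let `σ` be a linear isometry with `σu(t, σ⁻¹x) = −u(t, x)` for
all `t < 0`. At each time `t < 0`: the slice nonlinearity `(u·∇)u` is `σ`-EVEN
(`convect_conj_of_odd`), while `∂ₜu` and `Δu` are `σ`-ODD (`timeDerivWithin_conj_linearIsometryEquiv`,
`laplacian_conj_linearIsometryEquiv`); reflecting the momentum equation and ADDING,
`(u·∇)u + ∇p_even = d_even` with `p_even = ½(p + p∘σ⁻¹)` smooth and `d_even = ½(d + σ̂d)`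
co-band-limited (`even_split`). So the nonlinearity is co-band-limited modulo a gradient at every
time — exactly the hypothesis of N3 (`NonlinearityLoadBearing.eq_zero_of_convect_coband`): the
solution solves forced STOKES with a rung-invisible force and vanishes by the ancient Stokes
Liouville theorem. (Unlike N7 no hypothesis on `J₃` is needed: there is no precession term in
physical variables.)

## Results

* `even_split` — the even part of `A + N + ∇Q = E` (A odd, N even) is `N + ∇q = co-band`;
* **`rungSolution_eq_zero_of_symmetryOdd`**, `rungProfile_eq_zero_of_symmetryOdd`,
  `not_symmetryOdd_of_ne_zero` (a `RungIsSingular` witness admits no reversing isometry);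
* **`rungProfile_eq_zero_of_even`**: a Type-I rotated-DSS rung profile with EVEN slices
  `u(t, −x) = u(t, x)` (`t < 0`) is trivial; **`no_windowProfile_even`**,
  `no_windowProfile_symmetryOdd`: no window profile (K2's objects, amplitude floor `δ > 0`) has
  such a symmetry.

LABEL: KERNEL, unconditional. WHAT THIS IS NOT: not Navier–Stokes evidence; no profile is
constructed; rung solutions without an odd symmetry are untouched. References:
[cite: MajdaBertozziCUP2002, §1.2 Prop. 1.1]; [cite: KochNadirashviliSereginSverak2009, (1.6)]
(Type-I weight); [cite: ChaeWolf2017, Def. 1.1] (rotated DSS profiles).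
-/

noncomputable section

namespace Summit.NavierStokesRegularity.AngularGalerkinLadderSymmetryOddRungSolutionsExcluded

open Set Function
open scoped ContDiff RealInnerProductSpace Laplacian
open Literature.Analysis.FluidPDE
open Summit.NavierStokesRegularity.FluidComputer Summit.NavierStokesRegularity.FluidComputer.AngularLadder
open Summit.NavierStokesRegularity.AngularGalerkinLadderNonlinearityLoadBearing
open Summit.NavierStokesRegularity.AngularGalerkinLadderOddProfilesExcluded

variable {L : ℕ} {C₀ : ℝ}
  {u : ℝ → EuclideanSpace ℝ (Fin 3) → EuclideanSpace ℝ (Fin 3)}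
  {p : ℝ → EuclideanSpace ℝ (Fin 3) → ℝ}
  {d : ℝ → EuclideanSpace ℝ (Fin 3) → EuclideanSpace ℝ (Fin 3)}
  (σ : EuclideanSpace ℝ (Fin 3) ≃ₗᵢ[ℝ] EuclideanSpace ℝ (Fin 3))

/-! ## §1 The even part of a reflected equation -/

/-- **Even splitting.** From `A + N + ∇Q = E` with `A` odd, `N` even under `σ`, `Q` smooth and
`E` continuous co-band-limited: `N + ∇q` is co-band-limited for the smooth
`q = ½(Q + Q∘σ⁻¹)`. [folklore] -/
theorem even_split {A N E : EuclideanSpace ℝ (Fin 3) → EuclideanSpace ℝ (Fin 3)}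
    {Q : EuclideanSpace ℝ (Fin 3) → ℝ}
    (hQ : ContDiff ℝ ∞ Q) (hE : IsCobandLimited L E) (hEc : Continuous E)
    (heq : ∀ y, A y + N y + gradient Q y = E y)
    (hAodd : ∀ y, σ (A (σ.symm y)) = -A y) (hNeven : ∀ y, σ (N (σ.symm y)) = N y) :
    ∃ q : EuclideanSpace ℝ (Fin 3) → ℝ, ContDiff ℝ ∞ q ∧
      IsCobandLimited L fun y => N y + gradient q y := by
  have heq' : ∀ y, -A y + N y + gradient (fun z => Q (σ.symm z)) y = σ (E (σ.symm y)) := by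
    intro y
    rw [gradient_comp_linearIsometryEquiv_symm σ Q y, ← hAodd y, ← hNeven y, ← map_add,
      ← map_add, heq (σ.symm y)]
  have hQσ : ContDiff ℝ ∞ (fun z => Q (σ.symm z)) :=
    hQ.comp σ.symm.toContinuousLinearEquiv.contDiff
  refine ⟨fun z => (1 / 2 : ℝ) * (Q z + Q (σ.symm z)), contDiff_const.mul (hQ.add hQσ), ?_⟩
  have hEσc : Continuous (fun y => σ (E (σ.symm y))) :=
    σ.continuous.comp (hEc.comp σ.symm.continuous)
  have h := (hE.add (hE.conj_linearIsometryEquiv σ) hEc hEσc).smul (1 / 2 : ℝ)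
  have e : (fun y => N y + gradient (fun z => (1 / 2 : ℝ) * (Q z + Q (σ.symm z))) y) =
      (1 / 2 : ℝ) • (E + fun y => σ (E (σ.symm y))) := by
    funext y
    have hd1 : DifferentiableAt ℝ Q y := (hQ.differentiable (by simp)) y
    have hd2 : DifferentiableAt ℝ (fun z => Q (σ.symm z)) y := (hQσ.differentiable (by simp)) y
    have hg : gradient (fun z => (1 / 2 : ℝ) * (Q z + Q (σ.symm z))) y =
        (1 / 2 : ℝ) • (gradient Q y + gradient (fun z => Q (σ.symm z)) y) := by
      simp only [gradient, fderiv_const_mul (hd1.fun_add hd2), fderiv_fun_add hd1 hd2, map_smul,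
        map_add]
    rw [hg, Pi.smul_apply, Pi.add_apply, ← heq y, ← heq' y]
    module
  rw [e]
  exact h

/-! ## §2 Symmetry-odd rung solutions vanish -/

/-- **SYMMETRY-ODD RUNG SOLUTIONS ARE TRIVIAL.** A rung-`L` solution on `(−∞, 0)` with the
Type-I bound whose slices satisfy `σu(t, σ⁻¹x) = −u(t, x)` (`t < 0`) for a linear isometry `σ`
vanishes identically: its nonlinearity is co-band-limited modulo a gradient at every time (even
part of the reflected momentum equation), and N3 applies. [folklore] -/
theorem rungSolution_eq_zero_of_symmetryOdd (h : IsRungSolutionOn (Iio 0) 1 L u p d)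
    (hdec : ∀ t < 0, ∀ x, ‖u t x‖ ≤ C₀ / (‖x‖ + Real.sqrt (-t)))
    (hodd : ∀ t < 0, ∀ x, σ (u t (σ.symm x)) = -u t x) : ∀ t < 0, ∀ x, u t x = 0 := by
  have hS : UniqueDiffOn ℝ (Iio (0 : ℝ)) := uniqueDiffOn_Iio 0
  refine eq_zero_of_convect_coband h hdec fun t ht => ?_
  have hcl := h.1
  have htS : t ∈ Iio (0 : ℝ) := ht
  have hconj : (fun y => σ (u t (σ.symm y))) = -u t := funext fun y => by rw [hodd t ht y]; rfl
  -- the Laplacian and the time derivative of the slice are odd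
  have hΔ : ∀ y, σ ((Δ (u t)) (σ.symm y)) = -(Δ (u t)) y := fun y => by
    rw [← laplacian_conj_linearIsometryEquiv σ (u t) y, hconj, InnerProductSpace.laplacian_neg]
    rfl
  have hT : ∀ y, σ (timeDerivWithin (Iio 0) u t (σ.symm y)) = -timeDerivWithin (Iio 0) u t y :=
    fun y => by
    have hEqOn : EqOn (fun s => σ (u s (σ.symm y))) (fun s => -u s y) (Iio 0) :=
      fun s hs => hodd s hs y
    rw [← timeDerivWithin_conj_linearIsometryEquiv σ hcl.smooth_velocity hS htS y,
      timeDerivWithin_apply, timeDerivWithin_apply, derivWithin_congr hEqOn (hodd t ht y)]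
    show derivWithin (-fun s => u s y) (Iio 0) t = _
    rw [derivWithin.neg]
  -- the momentum equation as `A + N + ∇p = d`, `A = ∂ₜu − Δu`
  have heq : ∀ y, (timeDerivWithin (Iio 0) u t y - (1 : ℝ) • (Δ (u t)) y) +
      convect (u t) (u t) y + gradient (p t) y = d t y := fun y => by
    have h1 := hcl.momentum t htS y
    rw [eq_sub_of_add_eq h1]
    abel
  have hAodd : ∀ y, σ ((fun z => timeDerivWithin (Iio 0) u t z - (1 : ℝ) • (Δ (u t)) z) (σ.symm y)) =
      -((fun z => timeDerivWithin (Iio 0) u t z - (1 : ℝ) • (Δ (u t)) z) y) := fun y => by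
    simp only [one_smul, map_sub, hT, hΔ]
    abel
  have hNeven : ∀ y, σ (convect (u t) (u t) (σ.symm y)) = convect (u t) (u t) y :=
    convect_conj_of_odd σ (fun y => hodd t ht y)
  exact even_split σ (hcl.contDiff_pressure htS) (h.2.2 t htS) (hcl.continuous_force_slice hS htS)
    heq hAodd hNeven

/-- **Symmetry-odd rung PROFILES are trivial** (Type-I rotated-DSS ancient rung profiles of the
route, any factor `c`, any rotation `R`). [folklore] -/
theorem rungProfile_eq_zero_of_symmetryOdd {c : ℝ}
    {R : EuclideanSpace ℝ (Fin 3) ≃ₗᵢ[ℝ] EuclideanSpace ℝ (Fin 3)}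
    (h : IsRungProfile L C₀ c R u p d)
    (hodd : ∀ t < 0, ∀ x, σ (u t (σ.symm x)) = -u t x) : ∀ t < 0, ∀ x, u t x = 0 :=
  rungSolution_eq_zero_of_symmetryOdd σ h.1 h.hasTypeIDecay hodd

/-- **EVEN rung profiles are trivial**: `u(t, −x) = u(t, x)` for all `t < 0`, `x` forces
`u ≡ 0` on the past (`σ = −1`). [folklore] -/
theorem rungProfile_eq_zero_of_even {c : ℝ}
    {R : EuclideanSpace ℝ (Fin 3) ≃ₗᵢ[ℝ] EuclideanSpace ℝ (Fin 3)}
    (h : IsRungProfile L C₀ c R u p d)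
    (heven : ∀ t < 0, ∀ x, u t (-x) = u t x) : ∀ t < 0, ∀ x, u t x = 0 :=
  rungProfile_eq_zero_of_symmetryOdd (LinearIsometryEquiv.neg ℝ) h fun t ht x => by
    simp [LinearIsometryEquiv.symm_neg, LinearIsometryEquiv.coe_neg, heven t ht]

/-- A rung profile that witnesses `RungIsSingular` (`u(t, x) ≠ 0` somewhere on the past) admits
NO reversing linear isometry. [folklore] -/
theorem not_symmetryOdd_of_ne_zero {c : ℝ}
    {R : EuclideanSpace ℝ (Fin 3) ≃ₗᵢ[ℝ] EuclideanSpace ℝ (Fin 3)}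
    (h : IsRungProfile L C₀ c R u p d) (hne : ∃ t < 0, ∃ x, u t x ≠ 0) :
    ¬ ∀ t < 0, ∀ x, σ (u t (σ.symm x)) = -u t x := by
  intro hodd
  obtain ⟨t, ht, x, hx⟩ := hne
  exact hx (rungProfile_eq_zero_of_symmetryOdd σ h hodd t ht x)

/-! ## §3 K2: no window profile has an odd symmetry -/

/-- **No window profile is symmetry-odd** (amplitude floor `δ > 0` at `t = −1`). [folklore] -/
theorem no_windowProfile_symmetryOdd {cmin cmax δ ε c : ℝ}
    {R : EuclideanSpace ℝ (Fin 3) ≃ₗᵢ[ℝ] EuclideanSpace ℝ (Fin 3)}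
    (hW : IsWindowProfile L C₀ cmin cmax δ ε c R u p d) (hδ : 0 < δ)
    (hodd : ∀ t < 0, ∀ x, σ (u t (σ.symm x)) = -u t x) : False := by
  obtain ⟨x₀, hx₀⟩ := hW.2.2.2.1
  have h0 := rungProfile_eq_zero_of_symmetryOdd σ hW.1 hodd (-1) (by norm_num) x₀
  rw [h0, norm_zero] at hx₀
  exact absurd hx₀ (not_le.2 hδ)

/-- **No window profile has even slices** `u(t, −x) = u(t, x)`. [folklore] -/
theorem no_windowProfile_even {cmin cmax δ ε c : ℝ}
    {R : EuclideanSpace ℝ (Fin 3) ≃ₗᵢ[ℝ] EuclideanSpace ℝ (Fin 3)}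
    (hW : IsWindowProfile L C₀ cmin cmax δ ε c R u p d) (hδ : 0 < δ)
    (heven : ∀ t < 0, ∀ x, u t (-x) = u t x) : False := by
  obtain ⟨x₀, hx₀⟩ := hW.2.2.2.1
  have h0 := rungProfile_eq_zero_of_even hW.1 heven (-1) (by norm_num) x₀
  rw [h0, norm_zero] at hx₀
  exact absurd hx₀ (not_le.2 hδ)

end Summit.NavierStokesRegularity.AngularGalerkinLadderSymmetryOddRungSolutionsExcluded

end
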